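import Literature.RepresentationTheory.HeisenbergGroup.CharacterDualLattice
import Literature.RepresentationTheory.HeisenbergGroup.HeisenbergGroup
import Mathlib.Algebra.GroupWithZero.Subgroup
import Mathlib.RepresentationTheory.Basic
import Mathlib.Topology.Algebra.ConstMulAction
import HarnessLib

/-!
# Dual lattice pairs for a polarised pairing `ψ(β x y)`: the abstract form of MVW's self-dual lattice `A = B₁ × B₁^⊥`,
# its unit scalings, the descended characters of `K / M`, and the averaging step for an abstract Weyl pair

Topic `RepresentationTheory/HeisenbergGroup`; namespace `Literature.RepresentationTheory.HeisenbergGroup`.  KERNEL ONLY: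
one `Prop`-valued structure (`IsDualLatticePair`), one definition with body (`latticeQuotChar`) and proved theorems; no
named fact, no record, no `sorry`.

The tree's kernel proof of the UNIQUENESS half of the Stone–von Neumann theorem at a finite place
(`CharacterDualLattice.lean`, `WeylPairLatticeVector.lean`, `StoneVonNeumannUniqueness.lean`) is written for `Fⁿ` over a
non-archimedean normed field, the pairing `x · T y` (`T ∈ GL_n(F)`) and closed balls.  Read abstractly, it uses exactly
this: a pairing `β : X →ₗ[R] Y →ₗ[R] R` over a commutative ring `R` composed with a character `ψ : R → S¹`; ONE pair of
compact open additive subgroups `B₁ ≤ X`, `B₂ ≤ Y` in duality (`B₂ = B₁^⊥ = {y ; ψ(β x y) = 1 ∀ x ∈ B₁}` and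
`B₁ = ^⊥B₂`) — MVW's self-dual lattice `A = B₁ × B₂` of `W = X ⊕ Y`, [MoeglinVignerasWaldspurger1987, Chap. 2 I.3]
"`(A^⊥)^⊥ = A`", [Weil1964, Chap. I n° 11] (the lattice `L × L_*` over a local field), [Weil1964, Chap. III n° 37–39]
(the adelic lattice `∏_v X_v°`); and the SCALINGS `a B₁`, `a⁻¹ B₂` by units `a ∈ Rˣ`, again dual lattice pairs, which
over `F_v` (powers of a uniformiser) and over the finite adèles (non-zero integers, units of `F ⊂ 𝐀_fin`) shrink to `0`.
This file isolates that structure so that ONE kernel proof serves every finite place and the finite-adelic Heisenberg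
group alike (consumer: `StoneVonNeumannLatticePair.lean`):

* §1 **`IsDualLatticePair β ψ B₁ B₂`** (compact, open, `B₂ = B₁^⊥`, `B₁ = ^⊥B₂`); separation in both variables
  (`exists_right_ne_one`, `exists_left_ne_one`); **`IsDualLatticePair.flip`** (the pair `(B₂, B₁)` for the flipped pairing
  `-βᵀ : Y → X → R`, the pairing of the Weyl relation read from the other side); **`IsDualLatticePair.smul`** /
  `smul_inv` (`(a B₁, a⁻¹ B₂)` is a dual lattice pair for `a ∈ Rˣ`, topologies moved by the homeomorphisms `a • ·`);
* §2 **`latticeQuotChar`**: for additive subgroups `K, M ≤ Y` and `x` with `ψ(β x m) = 1` on `M`, the character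
  `k ↦ ψ(β x k)` of `K ⧸ M` ("`A^⊥` s'identifie au dual de `W/A`", MVW I.3), with the injectivity criterion
  `apply_sub_eq_one_of_latticeQuotChar_eq`;
* §3 **the averaging step** (`exists_sum_fixed_ne_zero_of_isDualLatticePair`) for an abstract Weyl pair of
  representations `τ` of `X` and `μ` of `Y` on a complex vector space with `τ_x μ_y = ψ(β x y) μ_y τ_x`: given dual
  lattice pairs `(A, M)` and `(A₀, K)`, a subspace `W` stable under `τ(A)` and `μ(K)`, and `u ∈ W`, `u ≠ 0`
  fixed by `τ(A₀)`, some NON-ZERO `w ∈ W` is fixed by all of `τ(A)` — one of the averages `∑_{q ∈ A/A₀} τ_{s q} μ_y u`,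
  `y ∈ K`, which cannot all vanish by the finite Fourier inversion on `K / M` (`eq_zero_of_forall_sum_smul_eq_zero`) with
  the pairwise distinct characters `latticeQuotChar (s q)` (distinct by the separation `^⊥K = A₀`) — word for word the
  proof of `WeylPairLatticeVector.exists_sum_fixed_ne_zero`, with balls replaced by the members of the pairs.

Nothing of [MoeglinVignerasWaldspurger1987] or [Weil1964] is asserted; everything is proved from Mathlib and the tree.

## References
* [MoeglinVignerasWaldspurger1987] C. Mœglin, M.-F. Vignéras, J.-L. Waldspurger, *Correspondances de Howe sur un corps
  p-adique*, LNM 1291 (1987), Chap. 2 I.3 (`A^⊥`, `(A^⊥)^⊥ = A`, `A^⊥ ≅ (W/A)^`), I.8 (Lemme, the averaging over `A/A₀`).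
* [Weil1964] A. Weil, *Sur certains groupes d'opérateurs unitaires*, Acta Math. 111 (1964), Chap. I n° 11 (the lattice
  `L × L_*` over a local field), Chap. III n° 37–39 (the adelic case: restricted products with respect to the `X_v°`).
-/

set_option autoImplicit false

noncomputable section

open Set Filter Topology
open scoped Pointwise

namespace Literature.RepresentationTheory.HeisenbergGroup

variable {R : Type*} [CommRing R] {X Y : Type*} [AddCommGroup X] [Module R X] [AddCommGroup Y] [Module R Y]
  (β : X →ₗ[R] Y →ₗ[R] R) (ψ : AddChar R Circle)

/-- scaling the first variable moves to the second: `β (c x) y = β x (c y)`. [cite: MoeglinVignerasWaldspurger1987, Chap. 2 I.3] -/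
theorem apply_smul_left_eq (c : R) (x : X) (y : Y) : β (c • x) y = β x (c • y) := by
  rw [LinearMap.map_smul₂, map_smul]

/-- membership in the scaling of an additive subgroup by a unit: `x ∈ a S ↔ a⁻¹ x ∈ S`.
[cite: MoeglinVignerasWaldspurger1987, Chap. 2 I.3] -/
theorem mem_unitsSMul_addSubgroup_iff {M : Type*} [Monoid M] {A : Type*} [AddGroup A] [DistribMulAction M A] (a : Mˣ)
    (S : AddSubgroup A) (x : A) : x ∈ (a : M) • S ↔ ((a⁻¹ : Mˣ) : M) • x ∈ S := by
  rw [AddSubgroup.mem_smul_pointwise_iff_exists]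
  constructor
  · rintro ⟨s, hs, rfl⟩
    rwa [smul_smul, Units.inv_mul, one_smul]
  · intro hx
    exact ⟨_, hx, by rw [smul_smul, Units.mul_inv, one_smul]⟩

/-- the flipped pairing of the Weyl relation read from the other side: `(-βᵀ) y x = -β x y`. [cite: Weil1964, Chap. I n° 4] -/
theorem neg_flip_apply (x : X) (y : Y) : (-β.flip) y x = -β x y := by
  rw [LinearMap.neg_apply, LinearMap.neg_apply, LinearMap.flip_apply]

/-! ## §1 Dual lattice pairs -/

section Pair

variable [TopologicalSpace X] [TopologicalSpace Y]

/-- **a dual lattice pair** for the pairing `(x, y) ↦ ψ(β x y)`: compact open additive subgroups `B₁ ≤ X`, `B₂ ≤ Y`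
with `B₂ = B₁^⊥ = {y ; ∀ x ∈ B₁, ψ(β x y) = 1}` and `B₁ = ^⊥B₂ = {x ; ∀ y ∈ B₂, ψ(β x y) = 1}` — the two factors of a
self-dual lattice `A = B₁ × B₂` (`A^⊥ = A`) of `W = X ⊕ Y` compatible with the polarisation.
[cite: MoeglinVignerasWaldspurger1987, Chap. 2 I.3] -/
structure IsDualLatticePair (B₁ : AddSubgroup X) (B₂ : AddSubgroup Y) : Prop where
  /-- `B₁` is compact. -/
  isCompact_left : IsCompact (B₁ : Set X)
  /-- `B₁` is open. -/
  isOpen_left : IsOpen (B₁ : Set X)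
  /-- `B₂` is compact. -/
  isCompact_right : IsCompact (B₂ : Set Y)
  /-- `B₂` is open. -/
  isOpen_right : IsOpen (B₂ : Set Y)
  /-- `B₂ = B₁^⊥`. -/
  mem_right_iff : ∀ y : Y, y ∈ B₂ ↔ ∀ x ∈ B₁, ψ (β x y) = 1
  /-- `B₁ = ^⊥B₂`. -/
  mem_left_iff : ∀ x : X, x ∈ B₁ ↔ ∀ y ∈ B₂, ψ (β x y) = 1

namespace IsDualLatticePair

variable {β ψ} {B₁ : AddSubgroup X} {B₂ : AddSubgroup Y}

/-- on `B₁ × B₂` the bicharacter is trivial. [cite: MoeglinVignerasWaldspurger1987, Chap. 2 I.3] -/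
theorem apply_eq_one (h : IsDualLatticePair β ψ B₁ B₂) {x : X} {y : Y} (hx : x ∈ B₁) (hy : y ∈ B₂) :
    ψ (β x y) = 1 :=
  (h.mem_right_iff y).1 hy x hx

/-- **separation in the first variable** (`^⊥(B₁^⊥) = B₁`): `x ∉ B₁ ⇒ ψ(β x y) ≠ 1` for some `y ∈ B₂`.
[cite: MoeglinVignerasWaldspurger1987, Chap. 2 I.3] -/
theorem exists_right_ne_one (h : IsDualLatticePair β ψ B₁ B₂) {x : X} (hx : x ∉ B₁) :
    ∃ y ∈ B₂, ψ (β x y) ≠ 1 := by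
  by_contra hne
  push Not at hne
  exact hx ((h.mem_left_iff x).2 hne)

/-- **separation in the second variable** (`(^⊥B₂)^⊥ = B₂`): `y ∉ B₂ ⇒ ψ(β x y) ≠ 1` for some `x ∈ B₁`.
[cite: MoeglinVignerasWaldspurger1987, Chap. 2 I.3] -/
theorem exists_left_ne_one (h : IsDualLatticePair β ψ B₁ B₂) {y : Y} (hy : y ∉ B₂) :
    ∃ x ∈ B₁, ψ (β x y) ≠ 1 := by
  by_contra hne
  push Not at hne
  exact hy ((h.mem_right_iff y).2 hne)

/-- `B₂ ≤ K` whenever `(A₀, K)` is a dual lattice pair with `A₀ ≤ B₁` (duality reverses inclusions).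
[cite: MoeglinVignerasWaldspurger1987, Chap. 2 I.3] -/
theorem right_le (h : IsDualLatticePair β ψ B₁ B₂) {A₀ : AddSubgroup X} {K : AddSubgroup Y}
    (h₀ : IsDualLatticePair β ψ A₀ K) (hle : A₀ ≤ B₁) : B₂ ≤ K :=
  fun y hy => (h₀.mem_right_iff y).2 fun _ hx => h.apply_eq_one (hle hx) hy

/-- **the flipped pair**: `(B₂, B₁)` is a dual lattice pair for the flipped pairing `-βᵀ : (y, x) ↦ -β x y` (the pairing
of the Weyl relation read from the other side; `ψ(-t) = 1 ↔ ψ(t) = 1`). [cite: MoeglinVignerasWaldspurger1987, Chap. 2 I.3] -/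
theorem flip (h : IsDualLatticePair β ψ B₁ B₂) : IsDualLatticePair (-β.flip) ψ B₂ B₁ where
  isCompact_left := h.isCompact_right
  isOpen_left := h.isOpen_right
  isCompact_right := h.isCompact_left
  isOpen_right := h.isOpen_left
  mem_right_iff x := by
    rw [h.mem_left_iff x]
    refine forall₂_congr fun y _ => ?_
    rw [LinearMap.neg_apply, LinearMap.neg_apply, LinearMap.flip_apply, AddChar.map_neg_eq_inv, inv_eq_one]
  mem_left_iff y := by
    rw [h.mem_right_iff y]
    refine forall₂_congr fun x _ => ?_
    rw [LinearMap.neg_apply, LinearMap.neg_apply, LinearMap.flip_apply, AddChar.map_neg_eq_inv, inv_eq_one]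

/-- the same for the flipped pairing `βᵀ` without the sign. [cite: MoeglinVignerasWaldspurger1987, Chap. 2 I.3] -/
theorem flip' (h : IsDualLatticePair β ψ B₁ B₂) : IsDualLatticePair β.flip ψ B₂ B₁ where
  isCompact_left := h.isCompact_right
  isOpen_left := h.isOpen_right
  isCompact_right := h.isCompact_left
  isOpen_right := h.isOpen_left
  mem_right_iff x := by
    rw [h.mem_left_iff x]
    exact forall₂_congr fun y _ => by rw [LinearMap.flip_apply]
  mem_left_iff y := by
    rw [h.mem_right_iff y]
    exact forall₂_congr fun x _ => by rw [LinearMap.flip_apply]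

variable [ContinuousConstSMul R X] [ContinuousConstSMul R Y]

/-- **scaled pairs**: for a unit `a ∈ Rˣ`, `(a B₁, a⁻¹ B₂)` is again a dual lattice pair (`(a B₁)^⊥ = a⁻¹ B₁^⊥` by
bilinearity; compactness and openness move along the homeomorphisms `x ↦ a x`, `y ↦ a⁻¹ y`).
[cite: MoeglinVignerasWaldspurger1987, Chap. 2 I.3] -/
theorem smul (h : IsDualLatticePair β ψ B₁ B₂) (a : Rˣ) :
    IsDualLatticePair β ψ ((a : R) • B₁) (((a⁻¹ : Rˣ) : R) • B₂) where
  isCompact_left := by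
    rw [AddSubgroup.coe_pointwise_smul]
    exact h.isCompact_left.smul (a : R)
  isOpen_left := by
    rw [AddSubgroup.coe_pointwise_smul]
    exact h.isOpen_left.smul a
  isCompact_right := by
    rw [AddSubgroup.coe_pointwise_smul]
    exact h.isCompact_right.smul ((a⁻¹ : Rˣ) : R)
  isOpen_right := by
    rw [AddSubgroup.coe_pointwise_smul]
    exact h.isOpen_right.smul a⁻¹
  mem_right_iff y := by
    rw [mem_unitsSMul_addSubgroup_iff, inv_inv, h.mem_right_iff]
    constructor
    · intro hy x hx
      rw [mem_unitsSMul_addSubgroup_iff] at hx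
      have e : x = (a : R) • (((a⁻¹ : Rˣ) : R) • x) := by rw [smul_smul, Units.mul_inv, one_smul]
      rw [e, apply_smul_left_eq β (a : R)]
      exact hy _ hx
    · intro hy x hx
      rw [← apply_smul_left_eq β (a : R)]
      exact hy _ (AddSubgroup.smul_mem_pointwise_smul x (a : R) B₁ hx)
  mem_left_iff x := by
    rw [mem_unitsSMul_addSubgroup_iff, h.mem_left_iff]
    constructor
    · intro hx y hy
      rw [mem_unitsSMul_addSubgroup_iff, inv_inv] at hy
      have e : y = ((a⁻¹ : Rˣ) : R) • ((a : R) • y) := by rw [smul_smul, Units.inv_mul, one_smul]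
      rw [e, ← apply_smul_left_eq β ((a⁻¹ : Rˣ) : R)]
      exact hx _ hy
    · intro hx y hy
      rw [apply_smul_left_eq β ((a⁻¹ : Rˣ) : R)]
      exact hx _ (AddSubgroup.smul_mem_pointwise_smul y _ B₂ hy)

/-- the scaled pair written as `(a⁻¹ B₁, a B₂)`. [cite: MoeglinVignerasWaldspurger1987, Chap. 2 I.3] -/
theorem smul_inv (h : IsDualLatticePair β ψ B₁ B₂) (a : Rˣ) :
    IsDualLatticePair β ψ (((a⁻¹ : Rˣ) : R) • B₁) ((a : R) • B₂) := by
  simpa only [inv_inv] using h.smul a⁻¹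

end IsDualLatticePair

end Pair

/-! ## §2 The characters of `K ⧸ M` defined by the pairing -/

section Quotient

variable (K M : AddSubgroup Y)

/-- **the character `k ↦ ψ(β x k)` of `K`, descended to `K ⧸ M`** when it is trivial on `M` ("`A^⊥` s'identifie au dual
de `W/A`": the elements of `^⊥M` give characters of `K/M`). [cite: MoeglinVignerasWaldspurger1987, Chap. 2 I.3] -/
def latticeQuotChar (x : X) (hx : ∀ m ∈ M, ψ (β x m) = 1) : AddChar (K ⧸ M.addSubgroupOf K) ℂ where
  toFun := Quotient.lift (fun k : K => ((ψ (β x (k : Y)) : Circle) : ℂ)) fun a b hab => by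
    have hm : -(a : Y) + b ∈ M := by
      simpa [AddSubgroup.mem_addSubgroupOf] using QuotientAddGroup.leftRel_apply.mp hab
    have e : (b : Y) = a + (-(a : Y) + b) := by abel
    show ((ψ (β x (a : Y)) : Circle) : ℂ) = ψ (β x (b : Y))
    rw [e, map_add, AddChar.map_add_eq_mul, hx _ hm, mul_one]
  map_zero_eq_one' := by
    show ((ψ (β x ((0 : K) : Y)) : Circle) : ℂ) = 1
    rw [AddSubgroup.coe_zero, map_zero, AddChar.map_zero_eq_one, Circle.coe_one]
  map_add_eq_mul' a b := by
    induction a using QuotientAddGroup.induction_on with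
    | H a =>
      induction b using QuotientAddGroup.induction_on with
      | H b =>
        show ((ψ (β x ((a + b : K) : Y)) : Circle) : ℂ) =
          ((ψ (β x (a : Y)) : Circle) : ℂ) * ψ (β x (b : Y))
        rw [AddSubgroup.coe_add, map_add, AddChar.map_add_eq_mul, Circle.coe_mul]

/-- `latticeQuotChar` on a class: `ψ(β x k)`. [cite: MoeglinVignerasWaldspurger1987, Chap. 2 I.3] -/
@[simp] theorem latticeQuotChar_mk (x : X) (hx : ∀ m ∈ M, ψ (β x m) = 1) (k : K) :
    latticeQuotChar β ψ K M x hx (QuotientAddGroup.mk k) = ((ψ (β x (k : Y)) : Circle) : ℂ) := rfl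

/-- **injectivity criterion**: `latticeQuotChar x = latticeQuotChar x'` forces `ψ(β (x - x') k) = 1` for every `k ∈ K`
(so `x - x' ∈ ^⊥K`). [cite: MoeglinVignerasWaldspurger1987, Chap. 2 I.3] -/
theorem apply_sub_eq_one_of_latticeQuotChar_eq {x x' : X} (hx : ∀ m ∈ M, ψ (β x m) = 1)
    (hx' : ∀ m ∈ M, ψ (β x' m) = 1) (h : latticeQuotChar β ψ K M x hx = latticeQuotChar β ψ K M x' hx')
    {k : Y} (hk : k ∈ K) : ψ (β (x - x') k) = 1 := by
  have h1 := DFunLike.congr_fun h (QuotientAddGroup.mk ⟨k, hk⟩)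
  rw [latticeQuotChar_mk, latticeQuotChar_mk, Circle.coe_inj] at h1
  rw [map_sub, LinearMap.sub_apply, AddChar.map_sub_eq_div, h1, div_self']

end Quotient

/-! ## §3 The averaging step for an abstract Weyl pair `τ_x μ_y = ψ(β x y) μ_y τ_x` -/

section Averaging

variable {E : Type*} [AddCommGroup E] [Module ℂ E]
  (τ : Representation ℂ (Multiplicative X) E) (μ : Representation ℂ (Multiplicative Y) E)

/-- for `z` fixed by `τ(A₀)`, `τ_a z` only depends on the class of `a ∈ A` modulo `A₀`.
[cite: MoeglinVignerasWaldspurger1987, Chap. 2 I.8] -/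
theorem apply_eq_of_mk_eq' {A A₀ : AddSubgroup X} {z : E}
    (hz : ∀ a ∈ A₀, τ (Multiplicative.ofAdd a) z = z) {a b : A}
    (h : (QuotientAddGroup.mk a : A ⧸ A₀.addSubgroupOf A) = QuotientAddGroup.mk b) :
    τ (Multiplicative.ofAdd (a : X)) z = τ (Multiplicative.ofAdd (b : X)) z := by
  have hm : -(a : X) + b ∈ A₀ := by
    have := QuotientAddGroup.eq.mp h
    rwa [AddSubgroup.mem_addSubgroupOf, AddSubgroup.coe_add, AddSubgroup.coe_neg] at this
  have e : (b : X) = a + (-(a : X) + b) := by abel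
  rw [e, ofAdd_add, map_mul, Module.End.mul_apply, hz _ hm]

/-- **averages over `A/A₀` are `A`-invariant**: for `z` fixed by `τ(A₀)` and the section `Quotient.out` of
`A → A/A₀`, `τ_a (∑_q τ_{s q} z) = ∑_q τ_{s q} z` for `a ∈ A` (translation by `a` permutes the classes).
[cite: MoeglinVignerasWaldspurger1987, Chap. 2 I.8] -/
theorem apply_sum_out_eq' {A A₀ : AddSubgroup X} [Fintype (A ⧸ A₀.addSubgroupOf A)] {z : E}
    (hz : ∀ a ∈ A₀, τ (Multiplicative.ofAdd a) z = z) {a : X} (ha : a ∈ A) :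
    τ (Multiplicative.ofAdd a) (∑ q : A ⧸ A₀.addSubgroupOf A, τ (Multiplicative.ofAdd (q.out : X)) z) =
      ∑ q : A ⧸ A₀.addSubgroupOf A, τ (Multiplicative.ofAdd (q.out : X)) z := by
  rw [map_sum]
  have step : ∀ q : A ⧸ A₀.addSubgroupOf A,
      τ (Multiplicative.ofAdd a) (τ (Multiplicative.ofAdd (q.out : X)) z) =
        τ (Multiplicative.ofAdd (((QuotientAddGroup.mk (⟨a, ha⟩ : A) + q).out : A) : X)) z := by
    intro q
    rw [← Module.End.mul_apply, ← map_mul, ← ofAdd_add]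
    have e : a + (q.out : X) = (((⟨a, ha⟩ : A) + q.out : A) : X) := rfl
    rw [e]
    refine apply_eq_of_mk_eq' τ hz ?_
    rw [QuotientAddGroup.mk_add, QuotientAddGroup.out_eq', QuotientAddGroup.out_eq']
  simp_rw [step]
  exact Equiv.sum_comp (Equiv.addLeft (QuotientAddGroup.mk (⟨a, ha⟩ : A) : A ⧸ A₀.addSubgroupOf A))
    (fun q => τ (Multiplicative.ofAdd ((q.out : A) : X)) z)

variable [TopologicalSpace X] [IsTopologicalAddGroup X] [TopologicalSpace Y] [IsTopologicalAddGroup Y]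

/-- **the averaging step.**  `τ`, `μ` representations of the additive groups `X`, `Y` on a complex vector space with the
Weyl relation `τ_x μ_y = ψ(β x y) μ_y τ_x`; `(A, M)` and `(A₀, K)` dual lattice pairs (so `A/(A ∩ A₀)` and `K/(K ∩ M)`
are finite); `W` a subspace stable under `τ(A)` and `μ(K)`.  If `u ∈ W`, `u ≠ 0`, is fixed by `τ(A₀)`, then some NON-ZERO
`w ∈ W` is fixed by all of `τ(A)` — namely one of the averages `∑_{q ∈ A/A₀} τ_{s q} μ_y u`, `y ∈ K`, which cannot all
vanish: applying `μ_{-y}` would give `∑_q ψ(β (s q) y) τ_{s q} u = 0` for all `y ∈ K`, a vanishing combination with the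
pairwise distinct (separation `^⊥K = A₀`) characters `latticeQuotChar (s q)` of the finite group `K/M`, whence
`τ_{s q} u = 0` by finite Fourier inversion. [cite: MoeglinVignerasWaldspurger1987, Chap. 2 I.8] -/
theorem exists_sum_fixed_ne_zero_of_isDualLatticePair
    (hcomm : ∀ (x : X) (y : Y) (v : E), τ (Multiplicative.ofAdd x) (μ (Multiplicative.ofAdd y) v) =
      ((ψ (β x y) : Circle) : ℂ) • μ (Multiplicative.ofAdd y) (τ (Multiplicative.ofAdd x) v))
    {A A₀ : AddSubgroup X} {M K : AddSubgroup Y} (hA : IsDualLatticePair β ψ A M)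
    (hA₀ : IsDualLatticePair β ψ A₀ K)
    (W : Submodule ℂ E) (hWτ : ∀ a ∈ A, ∀ w ∈ W, τ (Multiplicative.ofAdd a) w ∈ W)
    (hWμ : ∀ y ∈ K, ∀ w ∈ W, μ (Multiplicative.ofAdd y) w ∈ W)
    {u : E} (huW : u ∈ W) (hu0 : u ≠ 0) (hu : ∀ a ∈ A₀, τ (Multiplicative.ofAdd a) u = u) :
    ∃ w ∈ W, w ≠ 0 ∧ ∀ a ∈ A, τ (Multiplicative.ofAdd a) w = w := by
  classical
  -- the finite quotients `A / A₀` and `K / M`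
  haveI : Finite (A ⧸ A₀.addSubgroupOf A) := finite_quotient_of_isCompact_isOpen A A₀ hA.isCompact_left hA₀.isOpen_left
  haveI : Fintype (A ⧸ A₀.addSubgroupOf A) := Fintype.ofFinite _
  haveI : Finite (K ⧸ M.addSubgroupOf K) := finite_quotient_of_isCompact_isOpen K M hA₀.isCompact_right hA.isOpen_right
  haveI : Fintype (K ⧸ M.addSubgroupOf K) := Fintype.ofFinite _
  have hsA : ∀ q : A ⧸ A₀.addSubgroupOf A, ((q.out : A) : X) ∈ A := fun q => (q.out : A).2
  -- (i) `μ_y u` is `τ(A₀)`-fixed for `y ∈ K`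
  have hfix : ∀ y ∈ K, ∀ a ∈ A₀,
      τ (Multiplicative.ofAdd a) (μ (Multiplicative.ofAdd y) u) = μ (Multiplicative.ofAdd y) u := by
    intro y hy a ha
    rw [hcomm, hu a ha, hA₀.apply_eq_one ha hy, Circle.coe_one, one_smul]
  -- (ii) the averages `w_y = ∑_q τ_{s q} μ_y u` are `τ(A)`-fixed and lie in `W`
  have hwfix : ∀ y ∈ K, ∀ a ∈ A,
      τ (Multiplicative.ofAdd a) (∑ q : A ⧸ A₀.addSubgroupOf A,
        τ (Multiplicative.ofAdd ((q.out : A) : X)) (μ (Multiplicative.ofAdd y) u)) =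
      ∑ q : A ⧸ A₀.addSubgroupOf A,
        τ (Multiplicative.ofAdd ((q.out : A) : X)) (μ (Multiplicative.ofAdd y) u) :=
    fun y hy a ha => apply_sum_out_eq' τ (hfix y hy) ha
  have hwW : ∀ y ∈ K, (∑ q : A ⧸ A₀.addSubgroupOf A,
      τ (Multiplicative.ofAdd ((q.out : A) : X)) (μ (Multiplicative.ofAdd y) u)) ∈ W :=
    fun y hy => W.sum_mem fun q _ => hWτ _ (hsA q) _ (hWμ y hy u huW)
  -- (iii) they do not all vanish
  suffices hex : ∃ y ∈ K, (∑ q : A ⧸ A₀.addSubgroupOf A,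
      τ (Multiplicative.ofAdd ((q.out : A) : X)) (μ (Multiplicative.ofAdd y) u)) ≠ 0 by
    obtain ⟨y, hy, hne⟩ := hex
    exact ⟨_, hwW y hy, hne, hwfix y hy⟩
  by_contra hall
  push Not at hall
  -- applying `μ_{-y}`: the twisted sums `∑_q ψ(β (s q) y) τ_{s q} u` vanish for `y ∈ K`
  have hvan : ∀ y ∈ K, ∑ q : A ⧸ A₀.addSubgroupOf A,
      ((ψ (β ((q.out : A) : X) y) : Circle) : ℂ) • τ (Multiplicative.ofAdd ((q.out : A) : X)) u = 0 := by
    intro y hy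
    have h1 : μ (Multiplicative.ofAdd y) (∑ q : A ⧸ A₀.addSubgroupOf A,
        ((ψ (β ((q.out : A) : X) y) : Circle) : ℂ) • τ (Multiplicative.ofAdd ((q.out : A) : X)) u) = 0 := by
      rw [← hall y hy, map_sum]
      refine Finset.sum_congr rfl fun q _ => ?_
      rw [map_smul, hcomm]
    have h2 := congrArg (μ (Multiplicative.ofAdd (-y))) h1
    rwa [map_zero, ← Module.End.mul_apply, ← map_mul, ← ofAdd_add, neg_add_cancel, ofAdd_zero, map_one,
      Module.End.one_apply] at h2
  -- the characters `k ↦ ψ(β (s q) k)` of `K / M` are pairwise distinct (separation for `A₀`)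
  have hsM : ∀ q : A ⧸ A₀.addSubgroupOf A, ∀ m ∈ M, ψ (β ((q.out : A) : X) m) = 1 :=
    fun q m hm => hA.apply_eq_one (hsA q) hm
  have hθ : Function.Injective fun q : A ⧸ A₀.addSubgroupOf A =>
      latticeQuotChar β ψ K M ((q.out : A) : X) (hsM q) := by
    intro q q' hqq'
    have h1 : ∀ k ∈ K, ψ (β (((q.out : A) : X) - ((q'.out : A) : X)) k) = 1 :=
      fun k hk => apply_sub_eq_one_of_latticeQuotChar_eq β ψ K M (hsM q) (hsM q') hqq' hk
    have h2 : ((q.out : A) : X) - ((q'.out : A) : X) ∈ A₀ := by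
      by_contra hn
      obtain ⟨y, hy, hne⟩ := hA₀.exists_right_ne_one hn
      exact hne (h1 y hy)
    rw [← QuotientAddGroup.out_eq' q, ← QuotientAddGroup.out_eq' q']
    refine QuotientAddGroup.eq.mpr ?_
    rw [AddSubgroup.mem_addSubgroupOf, AddSubgroup.coe_add, AddSubgroup.coe_neg]
    have h3 := A₀.neg_mem h2
    rwa [neg_sub, sub_eq_neg_add] at h3
  -- finite Fourier inversion: `τ_{s q} u = 0`, contradicting `u ≠ 0`
  have hz : ∀ a' : K ⧸ M.addSubgroupOf K, ∑ q : A ⧸ A₀.addSubgroupOf A,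
      latticeQuotChar β ψ K M ((q.out : A) : X) (hsM q) a' •
        τ (Multiplicative.ofAdd ((q.out : A) : X)) u = 0 := by
    intro a'
    induction a' using QuotientAddGroup.induction_on with
    | H k => simpa only [latticeQuotChar_mk] using hvan k k.2
  have h0 := eq_zero_of_forall_sum_smul_eq_zero _ hθ _ hz (QuotientAddGroup.mk (0 : A))
  apply hu0
  have h4 := congrArg (τ (Multiplicative.ofAdd
    (-(((QuotientAddGroup.mk (0 : A) : A ⧸ A₀.addSubgroupOf A).out : A) : X)))) h0
  rwa [map_zero, ← Module.End.mul_apply, ← map_mul, ← ofAdd_add, neg_add_cancel, ofAdd_zero, map_one,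
    Module.End.one_apply] at h4

end Averaging

end Literature.RepresentationTheory.HeisenbergGroup

end
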